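import Literature.NumberTheory.GaloisRepresentations.GaloisRep
import Mathlib.NumberTheory.Padics.Complex
import Mathlib.LinearAlgebra.Matrix.Reindex
import HarnessLib

/-!
# Selmer bookkeeping for the realised cocycle — unramified part (stub `stub_realisedCocycleUnramified`)

Work file of a stub-worker of lead prover-line-stmt-Langlands-13639-c3-0 (line `sector-klingen-split`, crux
`ResiduallyYoshidaLifting`, stmt-Langlands-13639, skeleton rev 4).  If a framed `r : Γ_ℚ → GL₄(ℚ̄_p)` realises the residual
cocycle `B` through an integral frame `rint = P⁻¹ r P` with reduction `h (σ, B; 0, σ') h⁻¹`, then at every finite place `v`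
where `r` is unramified, `σ` and `σ'` are unramified and `B` vanishes on every inertia group above `v`: the realised class is
unramified wherever the realiser is (census §7 R1(b), the part of the `Sh`-Selmer condition away from `p`).
-/

noncomputable section

open scoped MatrixGroups

set_option linter.dupNamespace false
set_option autoImplicit false

namespace Summit.Langlands.Langlands.Cruxes.ResiduallyYoshidaLifting.SectorKlingenSplit.Ribet

/-- **Registered statement `stub_realisedCocycleUnramified`** (crux stmt-Langlands-13639, line `sector-klingen-split`, skeleton
rev 4): the realised cocycle vanishes on inertia wherever the realiser is unramified, and the residual constituents are
unramified there. [folklore] -/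
theorem stub_realisedCocycleUnramified :
    ∀ (p : ℕ) [Fact p.Prime] (k : Type) [Field k] [TopologicalSpace k] [DiscreteTopology k]
      (red : Valued.integer (PadicAlgCl p) →+* k)
      (σ σ' : Literature.NumberTheory.GaloisRepresentations.FramedGaloisRep ℚ k 2)
      (r : Literature.NumberTheory.GaloisRepresentations.FramedGaloisRep ℚ (PadicAlgCl p) 4)
      (P : GL (Fin 4) (PadicAlgCl p)) (rint : Field.absoluteGaloisGroup ℚ →* GL (Fin 4) (Valued.integer (PadicAlgCl p)))
      (h : GL (Fin 4) k) (B : Field.absoluteGaloisGroup ℚ → Matrix (Fin 2) (Fin 2) k),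
      (∀ g, Matrix.GeneralLinearGroup.map (Valued.integer (PadicAlgCl p)).subtype (rint g) = P⁻¹ * r g * P) →
      (∀ g, (Matrix.GeneralLinearGroup.map red (rint g)).val =
        h.val * Matrix.reindex finSumFinEquiv finSumFinEquiv (Matrix.fromBlocks (σ g).val (B g) 0 (σ' g).val) * (h⁻¹).val) →
      ∀ v : IsDedekindDomain.HeightOneSpectrum (NumberField.RingOfIntegers ℚ), r.IsUnramifiedAt v →
        σ.IsUnramifiedAt v ∧ σ'.IsUnramifiedAt v ∧
        ∀ 𝔓 ∈ v.primesAbove, ∀ i ∈ 𝔓.inertia (Field.absoluteGaloisGroup ℚ), B i = 0 := by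
  intro p _ k _ _ _ red σ σ' r P rint h B hP hred v hr
  -- the computation at one inertia element `i` above `v`
  have key : ∀ 𝔓 ∈ v.primesAbove, ∀ i ∈ 𝔓.inertia (Field.absoluteGaloisGroup ℚ),
      σ i = 1 ∧ B i = 0 ∧ σ' i = 1 := by
    intro 𝔓 h𝔓 i hi
    have hri : r i = 1 := hr 𝔓 h𝔓 i hi
    -- the integral frame is trivial at `i` (`GL₄(ℤ̄_p) → GL₄(ℚ̄_p)` is injective)
    have h1 : Matrix.GeneralLinearGroup.map (Valued.integer (PadicAlgCl p)).subtype (rint i) = 1 := by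
      rw [hP, hri, mul_one, inv_mul_cancel]
    have h2 : rint i = 1 := by
      refine Units.ext (Matrix.map_injective (f := ⇑(Valued.integer (PadicAlgCl p)).subtype)
        Subtype.val_injective ?_)
      have h1v := congrArg (fun u : GL (Fin 4) (PadicAlgCl p) => (u : Matrix (Fin 4) (Fin 4) (PadicAlgCl p))) h1
      simp only [Units.val_one] at h1v
      change ((rint i).val).map _ = ((1 : GL (Fin 4) (Valued.integer (PadicAlgCl p))).val).map _
      rw [Units.val_one, Matrix.map_one _ (map_zero _) (map_one _)]
      exact h1v
    -- hence so is its reduction, and the block matrix is `1`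
    have h4 : Matrix.reindex finSumFinEquiv finSumFinEquiv (Matrix.fromBlocks (σ i).val (B i) 0 (σ' i).val) =
        (1 : Matrix (Fin 4) (Fin 4) k) :=
      calc Matrix.reindex finSumFinEquiv finSumFinEquiv (Matrix.fromBlocks (σ i).val (B i) 0 (σ' i).val)
          = (h⁻¹).val * (h.val * Matrix.reindex finSumFinEquiv finSumFinEquiv
              (Matrix.fromBlocks (σ i).val (B i) 0 (σ' i).val) * (h⁻¹).val) * h.val := by
            simp only [Matrix.mul_assoc, Units.inv_mul_cancel_left, Units.inv_mul, Matrix.mul_one]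
        _ = (h⁻¹).val * (Matrix.GeneralLinearGroup.map red (rint i)).val * h.val := by rw [hred i]
        _ = 1 := by rw [h2, map_one, Units.val_one, Matrix.mul_one, Units.inv_mul]
    have h5 : Matrix.fromBlocks (σ i).val (B i) 0 (σ' i).val =
        Matrix.fromBlocks (1 : Matrix (Fin 2) (Fin 2) k) 0 0 (1 : Matrix (Fin 2) (Fin 2) k) := by
      apply (Matrix.reindex (finSumFinEquiv : Fin 2 ⊕ Fin 2 ≃ Fin (2 + 2))
        (finSumFinEquiv : Fin 2 ⊕ Fin 2 ≃ Fin (2 + 2))).injective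
      rw [h4, Matrix.fromBlocks_one, Matrix.reindex_apply, Matrix.submatrix_one_equiv]
    obtain ⟨hσ1, hB0, -, hσ'1⟩ := Matrix.fromBlocks_inj.mp h5
    exact ⟨Units.ext hσ1, hB0, Units.ext hσ'1⟩
  exact ⟨fun 𝔓 h𝔓 i hi => (key 𝔓 h𝔓 i hi).1, fun 𝔓 h𝔓 i hi => (key 𝔓 h𝔓 i hi).2.2,
    fun 𝔓 h𝔓 i hi => (key 𝔓 h𝔓 i hi).2.1⟩

end Summit.Langlands.Langlands.Cruxes.ResiduallyYoshidaLifting.SectorKlingenSplit.Ribet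

end
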